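import Summits.NavierStokesRegularity.NavierStokesRegularity.Theorems.AdaptedFrequencyTangentFlowTransferFiniteAB
import Summits.NavierStokesRegularity.NavierStokesRegularity.Theorems.AdaptedFrequencyFrequencyRigidityFiniteABGlue
import Summits.NavierStokesRegularity.NavierStokesRegularity.Theorems.AdaptedFrequencyAdaptedKernelExists
import Summits.NavierStokesRegularity.NavierStokesRegularity.Theorems.AdaptedFrequencySingularPointExists
import Summits.NavierStokesRegularity.NavierStokesRegularity.Theorems.AdaptedFrequencyFrequencyRigidityViscosityNormalisation
import Summits.NavierStokesRegularity.NavierStokesRegularity.Theorems.RecurrentProfilesTargetOfCruxes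
import Summits.NavierStokesRegularity.NavierStokesRegularity.Theorems.RecurrentProfilesRecurrentReduction
import HarnessLib

/-!
# Crux `FrequencyRigidity` (stmt-NavierStokesRegularity-2955), line `scaled-energy-split`:
# glue 2 for the finite child in Albritton–Barker form (Stub 2′) — the route closes, and
# Stub 2′ ⇐ `NoTypeIRateProfile`

Helper file (`--supports stmt-NavierStokesRegularity-2955`; theorems only, sorry-free).

Stub 2′ of the line (`stub_finiteScaledEnergyLiouvilleAB`) forbids an inhabitant
`(ν, C, Λ₀, v, q, K)` of the crux body — a classical ancient Navier–Stokes flow `(v, q)` on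
`ℝ³ × (−∞, 0)` with the global Type-I bound, an adapted Gaussian-comparable kernel `K` at the pole,
positive adapted enstrophy and constant adapted frequency — that lies in the Albritton–Barker class:
SOME suitable pressure `ϖ` and weak spatial gradient `G'` on the open backward slab with
`typeIBound (ℝ₋ × ℝ³) v ϖ G' < ⊤`.

This file records the two remaining pieces of pure bookkeeping around Stub 2′:

* `finiteAB_navierStokesRegularity_of_finiteChild` (registered sub-goal G3): the route
  `AdaptedFrequency` closes from `AdaptedFrequencyConverges`, Stub 2′ and `NoTypeII` ALONE — the
  landed glue `finiteAB_closes` instantiated at the landed enabler `tangentFlowTransfer_finiteAB`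
  (the tangent flow at a Type-I singular point lies in the Albritton–Barker class) and the tree
  proofs of `AdaptedKernelExists`, `SingularPointExists`, `NoBlowupToClay`;
* `finiteAB_stub2AB_of_noTypeIRateProfile` (registered sub-goal G4): Stub 2′ FOLLOWS FROM the
  target `NoTypeIRateProfile` (stmt-NavierStokesRegularity-1588) of route RecurrentProfiles: a
  Stub-2′ witness is backward-singular at the pole (`isBackwardSingularPoint_of_witness`); its
  viscosity normalisation `u(s, y) = ν⁻¹ v(ν⁻¹ s, y)` (`finiteAB_abClause_dilate` with `β = ν⁻¹`)
  is a unit-viscosity suitable weak solution on the slab with a weak gradient, `𝐈 < ⊤`, the Type-I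
  rate `C/√ν` (`hasTypeITimeDecay_viscosity`) and a backward-singular origin
  (`isBackwardSingularPoint_viscosity`) — exactly what `NoTypeIRateProfile` forbids;
* `finiteAB_stub2AB_of_recurrentLiouville`, `finiteAB_stub2AB_of_recurrentLiouville'`
  (corollaries): Stub 2′ from the two cruxes `RecurrentLiouville`, `RecurrentReduction` of route
  RecurrentProfiles (tree glue `recurrentProfiles_targetOfCruxes_proof`), and from
  `RecurrentLiouville` alone (`RecurrentReduction` is proved in tree, `recurrentReduction_proof`).

## References

* D. Albritton, T. Barker, *On local Type I singularities of the Navier–Stokes equations and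
  Liouville theorems*, J. Math. Fluid Mech. 21 (2019), Thm 1.1, §1, §3. [AlbrittonBarker2019]
* T. Tao, *Localisation and compactness properties of the Navier–Stokes global regularity problem*,
  Anal. PDE 6 (2013), footnote 3 (viscosity normalisation). [Tao2011]
-/

noncomputable section

set_option linter.dupNamespace false

namespace Summit.NavierStokesRegularity.NavierStokesRegularity.Theorems

open Literature.Analysis.FluidPDE MeasureTheory Set Function

/-- **The route closes from the finite child in Albritton–Barker form (registered sub-goal
`finiteAB_navierStokesRegularity_of_finiteChild` of line `scaled-energy-split`).**  Route
`AdaptedFrequency` reaches `NavierStokesRegularity` from `AdaptedFrequencyConverges`, Stub 2′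
(`stub_finiteScaledEnergyLiouvilleAB`) and `NoTypeII` alone: the landed glue `finiteAB_closes` (the
route's deciding chain with `FrequencyRigidity` replaced by Stub 2′ and `TangentFlowTransfer` by its
Albritton–Barker strengthening) instantiated at the landed enabler `tangentFlowTransfer_finiteAB` and
the tree proofs `adaptedFrequency_adaptedKernelExists_proof`, `singularPointExists_proof`,
`NoBlowupToClay_holds`.  Pure logic over landed theorems. -/
theorem finiteAB_navierStokesRegularity_of_finiteChild : Summit.NavierStokesRegularity.NavierStokesRegularity.Theses.AdaptedFrequency.AdaptedFrequencyConverges → (¬ ∃ (ν C Λ₀ : ℝ) (v : ℝ → EuclideanSpace ℝ (Fin 3) → EuclideanSpace ℝ (Fin 3)) (q : ℝ → EuclideanSpace ℝ (Fin 3) → ℝ) (K : ℝ → EuclideanSpace ℝ (Fin 3) → ℝ), (0 < ν ∧ Literature.Analysis.FluidPDE.IsClassicalNSSolutionOn (Set.Iio 0) ν 0 v q ∧ (∀ t ∈ Set.Iio (0:ℝ), ∀ x, ‖v t x‖ ≤ C / Real.sqrt (-t)) ∧ ContDiffOn ℝ 2 (Function.uncurry K) (Set.Iio (0:ℝ) ×ˢ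 Set.univ) ∧ (∀ t ∈ Set.Iio (0:ℝ), ∀ x, 0 < K t x) ∧ (∀ t ∈ Set.Iio (0:ℝ), ∀ x, Literature.Analysis.FluidPDE.timeDerivWithin (Set.Iio (0:ℝ)) K t x + fderiv ℝ (K t) x (v t x) + ν * Laplacian.laplacian (K t) x = 0) ∧ (∀ t ∈ Set.Iio (0:ℝ), ∫ x, K t x = 1) ∧ (∀ φ : EuclideanSpace ℝ (Fin 3) → ℝ, Continuous φ → (∃ M : ℝ, ∀ x, |φ x| ≤ M) → Filter.Tendsto (fun t => ∫ x, φ x * K t x) (nhdsWithin (0:ℝ) (Set.Iio (0:ℝ))) (nhds (φ (0 : EuclideanSpace ℝ (Fin 3))))) ∧ (∃ c₁ c₂ C₁ C₂ : ℝ, 0 < c₁ ∧ 0 < c₂ ∧ 0 < C₁ ∧ 0 < C₂ ∧ ∀ t ∈ Set.Iio (0:ℝ), ∀ x, c₁ * ((0:ℝ) - t) ^ (-(3:ℝ) / 2) * Real.exp (-(‖x - (0 : EuclideanSpace ℝ (Fin 3))‖ ^ 2) / (c₂ * ((0:ℝ) - t))) ≤ K t x ∧ K t x ≤ C₁ * ((0:ℝ)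 - t) ^ (-(3:ℝ) / 2) * Real.exp (-(‖x - (0 : EuclideanSpace ℝ (Fin 3))‖ ^ 2) / (C₂ * ((0:ℝ) - t)))) ∧ (∀ H Λ : ℝ → ℝ, H = (fun t => ∫ x, ‖Literature.Analysis.FluidPDE.curl (v t) x‖ ^ 2 * K t x) → Λ = (fun t => (0 - t) * deriv H t / H t) → (∀ t ∈ Set.Iio (0:ℝ), 0 < H t) ∧ (∀ t ∈ Set.Iio (0:ℝ), Λ t = Λ₀))) ∧ (∃ (ϖ : ℝ → EuclideanSpace ℝ (Fin 3) → ℝ) (G' : ℝ → EuclideanSpace ℝ (Fin 3) → EuclideanSpace ℝ (Fin 3) →L[ℝ] EuclideanSpace ℝ (Fin 3)), Literature.Analysis.FluidPDE.IsSuitableWeakSolutionOn (Literature.Analysis.FluidPDE.slab (EuclideanSpace ℝ (Fin 3)) (Set.Iio 0) isOpen_Iio) ν 0 v ϖ ∧ Literature.Analysis.FluidPDE.HasWeakSpatialGradientOn (Literature.Analysis.FluidPDE.slab (EuclideanSpace ℝ (Fin 3)) (Set.Iio 0) isOpen_Iio) v G' ∧ Literature.Analysis.FluidPDE.typeIBound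 (Set.Iio (0:ℝ) ×ˢ Set.univ) v ϖ G' < ⊤)) → Summit.NavierStokesRegularity.NavierStokesRegularity.Theses.AdaptedFrequency.NoTypeII → NavierStokesRegularity :=
  fun hAFC h2' hNT2 =>
    finiteAB_closes hAFC h2' tangentFlowTransfer_finiteAB adaptedFrequency_adaptedKernelExists_proof
      singularPointExists_proof hNT2
      Summit.NavierStokesRegularity.NavierStokesRegularity.Theses.AdaptedFrequency.NoBlowupToClay_holds

/-- **Stub 2′ ⇐ stmt-1588 (registered sub-goal `finiteAB_stub2AB_of_noTypeIRateProfile` of line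
`scaled-energy-split`).**  The target `NoTypeIRateProfile` of route RecurrentProfiles — no suitable
weak solution of unit-viscosity Navier–Stokes on the slab `ℝ³ × (−∞, 0)` with a weak gradient,
finite Albritton–Barker quantity `𝐈` and the Type-I rate is backward-singular at the origin —
implies Stub 2′.  Given a Stub-2′ witness `(ν, C, Λ₀, v, q, K; ϖ, G')`: the pole is backward-singular
for `v` (`isBackwardSingularPoint_of_witness`: flat package + `H(t) = A(−t)⁻²` forces unboundedness
near the pole); the viscosity normalisation `u = ν⁻¹ v(ν⁻¹ ·, ·)`, `π = ν⁻² ϖ(ν⁻¹ ·, ·)`,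
`G = ν⁻¹ G'(ν⁻¹ ·, ·)` keeps the Albritton–Barker clause at viscosity `ν⁻¹ ν = 1`
(`finiteAB_abClause_dilate`), has the Type-I rate with constant `C/√ν`
(`hasTypeITimeDecay_viscosity`) and is still backward-singular at the origin
(`isBackwardSingularPoint_viscosity`); `NoTypeIRateProfile` says it is not.  Conditional on an OPEN
item (an implication, not a discharge). [cite: AlbrittonBarker2019, Thm 1.1] -/
theorem finiteAB_stub2AB_of_noTypeIRateProfile : Summit.NavierStokesRegularity.NavierStokesRegularity.Theses.RecurrentProfiles.NoTypeIRateProfile → (¬ ∃ (ν C Λ₀ : ℝ) (v : ℝ → EuclideanSpace ℝ (Fin 3) → EuclideanSpace ℝ (Fin 3)) (q : ℝ → EuclideanSpace ℝ (Fin 3) → ℝ) (K : ℝ → EuclideanSpace ℝ (Fin 3) → ℝ), (0 < ν ∧ Literature.Analysis.FluidPDE.IsClassicalNSSolutionOn (Set.Iio 0) ν 0 v q ∧ (∀ t ∈ Set.Iio (0:ℝ), ∀ x, ‖v t x‖ ≤ C / Real.sqrt (-t)) ∧ ContDiffOn ℝ 2 (Function.uncurry K) (Set.Iio (0:ℝ)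 ×ˢ Set.univ) ∧ (∀ t ∈ Set.Iio (0:ℝ), ∀ x, 0 < K t x) ∧ (∀ t ∈ Set.Iio (0:ℝ), ∀ x, Literature.Analysis.FluidPDE.timeDerivWithin (Set.Iio (0:ℝ)) K t x + fderiv ℝ (K t) x (v t x) + ν * Laplacian.laplacian (K t) x = 0) ∧ (∀ t ∈ Set.Iio (0:ℝ), ∫ x, K t x = 1) ∧ (∀ φ : EuclideanSpace ℝ (Fin 3) → ℝ, Continuous φ → (∃ M : ℝ, ∀ x, |φ x| ≤ M) → Filter.Tendsto (fun t => ∫ x, φ x * K t x) (nhdsWithin (0:ℝ) (Set.Iio (0:ℝ))) (nhds (φ (0 : EuclideanSpace ℝ (Fin 3))))) ∧ (∃ c₁ c₂ C₁ C₂ : ℝ, 0 < c₁ ∧ 0 < c₂ ∧ 0 < C₁ ∧ 0 < C₂ ∧ ∀ t ∈ Set.Iio (0:ℝ), ∀ x, c₁ * ((0:ℝ) - t) ^ (-(3:ℝ) / 2) * Real.exp (-(‖x - (0 : EuclideanSpace ℝ (Fin 3))‖ ^ 2) / (c₂ * ((0:ℝ) - t))) ≤ K t x ∧ K t x ≤ C₁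 * ((0:ℝ) - t) ^ (-(3:ℝ) / 2) * Real.exp (-(‖x - (0 : EuclideanSpace ℝ (Fin 3))‖ ^ 2) / (C₂ * ((0:ℝ) - t)))) ∧ (∀ H Λ : ℝ → ℝ, H = (fun t => ∫ x, ‖Literature.Analysis.FluidPDE.curl (v t) x‖ ^ 2 * K t x) → Λ = (fun t => (0 - t) * deriv H t / H t) → (∀ t ∈ Set.Iio (0:ℝ), 0 < H t) ∧ (∀ t ∈ Set.Iio (0:ℝ), Λ t = Λ₀))) ∧ (∃ (ϖ : ℝ → EuclideanSpace ℝ (Fin 3) → ℝ) (G' : ℝ → EuclideanSpace ℝ (Fin 3) → EuclideanSpace ℝ (Fin 3) →L[ℝ] EuclideanSpace ℝ (Fin 3)), Literature.Analysis.FluidPDE.IsSuitableWeakSolutionOn (Literature.Analysis.FluidPDE.slab (EuclideanSpace ℝ (Fin 3)) (Set.Iio 0) isOpen_Iio) ν 0 v ϖ ∧ Literature.Analysis.FluidPDE.HasWeakSpatialGradientOn (Literature.Analysis.FluidPDE.slab (EuclideanSpace ℝ (Fin 3)) (Set.Iio 0) isOpen_Iio) v G' ∧ Literature.Analysis.FluidPDE.typeIBound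 (Set.Iio (0:ℝ) ×ˢ Set.univ) v ϖ G' < ⊤)) := by
  intro h1588
  rintro ⟨ν, C, Λ₀, v, q, K, hbody, ϖ, G', hsw, hwg, hI⟩
  obtain ⟨hν, hNS, hTI, hKc, hCmp, hF⟩ :=
    (FrequencyRigidity.ScaledEnergySplit.body_iff_bundles ν C Λ₀ v q K).1 hbody
  -- (a) the pole is backward-singular
  have hsing : IsBackwardSingularPoint v 0 :=
    FrequencyRigidity.ScaledEnergySplit.isBackwardSingularPoint_of_witness hν hNS hTI hKc hCmp hF
  -- (b) normalise the viscosity: `β = ν⁻¹` in the A–B dilation clause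
  obtain ⟨hsw1, hwg1, hI1⟩ := finiteAB_abClause_dilate ν ν⁻¹ hν (inv_pos.2 hν) v ϖ G' hsw hwg hI
  rw [inv_mul_cancel₀ hν.ne'] at hsw1
  -- (c)+(d) Type-I rate `C/√ν` and backward singularity survive; stmt-1588 forbids the package
  exact h1588 _ _ _ (C / Real.sqrt ν) hsw1 hwg1 hI1
    (FrequencyRigidity.ScaledEnergySplit.hasTypeITimeDecay_viscosity hν hTI)
    (FrequencyRigidity.ScaledEnergySplit.isBackwardSingularPoint_viscosity hν hsing)

/-- **Stub 2′ from the two cruxes of route RecurrentProfiles**: `RecurrentLiouville` (a uniformly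
recurrent Type-I-rate profile of the local-energy class is regular at the origin) and
`RecurrentReduction` (an origin-singular class profile yields a uniformly recurrent origin-singular
one) give `NoTypeIRateProfile` (tree glue `recurrentProfiles_targetOfCruxes_proof`), hence Stub 2′
(`finiteAB_stub2AB_of_noTypeIRateProfile`).  Pure logic. -/
theorem finiteAB_stub2AB_of_recurrentLiouville : Summit.NavierStokesRegularity.NavierStokesRegularity.Theses.RecurrentProfiles.RecurrentLiouville → Summit.NavierStokesRegularity.NavierStokesRegularity.Theses.RecurrentProfiles.RecurrentReduction → (¬ ∃ (ν C Λ₀ : ℝ) (v : ℝ → EuclideanSpace ℝ (Fin 3) → EuclideanSpace ℝ (Fin 3)) (q : ℝ → EuclideanSpace ℝ (Fin 3) → ℝ) (K : ℝ → EuclideanSpace ℝ (Fin 3) → ℝ), (0 < ν ∧ Literature.Analysis.FluidPDE.IsClassicalNSSolutionOn (Set.Iio 0) ν 0 v q ∧ (∀ t ∈ Set.Iio (0:ℝ), ∀ x, ‖v t x‖ ≤ C / Real.sqrt (-t)) ∧ ContDiffOn ℝ 2 (Function.uncurry K) (Set.Iio (0:ℝ) ×ˢ Set.univ) ∧ (∀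 t ∈ Set.Iio (0:ℝ), ∀ x, 0 < K t x) ∧ (∀ t ∈ Set.Iio (0:ℝ), ∀ x, Literature.Analysis.FluidPDE.timeDerivWithin (Set.Iio (0:ℝ)) K t x + fderiv ℝ (K t) x (v t x) + ν * Laplacian.laplacian (K t) x = 0) ∧ (∀ t ∈ Set.Iio (0:ℝ), ∫ x, K t x = 1) ∧ (∀ φ : EuclideanSpace ℝ (Fin 3) → ℝ, Continuous φ → (∃ M : ℝ, ∀ x, |φ x| ≤ M) → Filter.Tendsto (fun t => ∫ x, φ x * K t x) (nhdsWithin (0:ℝ) (Set.Iio (0:ℝ))) (nhds (φ (0 : EuclideanSpace ℝ (Fin 3))))) ∧ (∃ c₁ c₂ C₁ C₂ : ℝ, 0 < c₁ ∧ 0 < c₂ ∧ 0 < C₁ ∧ 0 < C₂ ∧ ∀ t ∈ Set.Iio (0:ℝ), ∀ x, c₁ * ((0:ℝ) - t) ^ (-(3:ℝ) / 2) * Real.exp (-(‖x - (0 : EuclideanSpace ℝ (Fin 3))‖ ^ 2) / (c₂ * ((0:ℝ) - t))) ≤ K t x ∧ K t x ≤ C₁ * ((0:ℝ) - t) ^ (-(3:ℝ)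 / 2) * Real.exp (-(‖x - (0 : EuclideanSpace ℝ (Fin 3))‖ ^ 2) / (C₂ * ((0:ℝ) - t)))) ∧ (∀ H Λ : ℝ → ℝ, H = (fun t => ∫ x, ‖Literature.Analysis.FluidPDE.curl (v t) x‖ ^ 2 * K t x) → Λ = (fun t => (0 - t) * deriv H t / H t) → (∀ t ∈ Set.Iio (0:ℝ), 0 < H t) ∧ (∀ t ∈ Set.Iio (0:ℝ), Λ t = Λ₀))) ∧ (∃ (ϖ : ℝ → EuclideanSpace ℝ (Fin 3) → ℝ) (G' : ℝ → EuclideanSpace ℝ (Fin 3) → EuclideanSpace ℝ (Fin 3) →L[ℝ] EuclideanSpace ℝ (Fin 3)), Literature.Analysis.FluidPDE.IsSuitableWeakSolutionOn (Literature.Analysis.FluidPDE.slab (EuclideanSpace ℝ (Fin 3)) (Set.Iio 0) isOpen_Iio) ν 0 v ϖ ∧ Literature.Analysis.FluidPDE.HasWeakSpatialGradientOn (Literature.Analysis.FluidPDE.slab (EuclideanSpace ℝ (Fin 3)) (Set.Iio 0) isOpen_Iio) v G' ∧ Literature.Analysis.FluidPDE.typeIBound (Set.Iio (0:ℝ) ×ˢ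 Set.univ) v ϖ G' < ⊤)) :=
  fun hL hR => finiteAB_stub2AB_of_noTypeIRateProfile (recurrentProfiles_targetOfCruxes_proof hL hR)

/-- **Stub 2′ from `RecurrentLiouville` alone**: `RecurrentReduction` is proved in tree
(`recurrentReduction_proof`, Birkhoff–Furstenberg minimal set in the Albritton–Barker class), so the
single open crux `RecurrentLiouville` of route RecurrentProfiles already implies Stub 2′
(`finiteAB_stub2AB_of_recurrentLiouville`).  Pure logic. -/
theorem finiteAB_stub2AB_of_recurrentLiouville' : Summit.NavierStokesRegularity.NavierStokesRegularity.Theses.RecurrentProfiles.RecurrentLiouville → (¬ ∃ (ν C Λ₀ : ℝ) (v : ℝ → EuclideanSpace ℝ (Fin 3) → EuclideanSpace ℝ (Fin 3)) (q : ℝ → EuclideanSpace ℝ (Fin 3) → ℝ) (K : ℝ → EuclideanSpace ℝ (Fin 3) → ℝ), (0 < ν ∧ Literature.Analysis.FluidPDE.IsClassicalNSSolutionOn (Set.Iio 0) ν 0 v q ∧ (∀ t ∈ Set.Iio (0:ℝ), ∀ x, ‖v t x‖ ≤ C / Real.sqrt (-t)) ∧ ContDiffOn ℝ 2 (Function.uncurry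 K) (Set.Iio (0:ℝ) ×ˢ Set.univ) ∧ (∀ t ∈ Set.Iio (0:ℝ), ∀ x, 0 < K t x) ∧ (∀ t ∈ Set.Iio (0:ℝ), ∀ x, Literature.Analysis.FluidPDE.timeDerivWithin (Set.Iio (0:ℝ)) K t x + fderiv ℝ (K t) x (v t x) + ν * Laplacian.laplacian (K t) x = 0) ∧ (∀ t ∈ Set.Iio (0:ℝ), ∫ x, K t x = 1) ∧ (∀ φ : EuclideanSpace ℝ (Fin 3) → ℝ, Continuous φ → (∃ M : ℝ, ∀ x, |φ x| ≤ M) → Filter.Tendsto (fun t => ∫ x, φ x * K t x) (nhdsWithin (0:ℝ) (Set.Iio (0:ℝ))) (nhds (φ (0 : EuclideanSpace ℝ (Fin 3))))) ∧ (∃ c₁ c₂ C₁ C₂ : ℝ, 0 < c₁ ∧ 0 < c₂ ∧ 0 < C₁ ∧ 0 < C₂ ∧ ∀ t ∈ Set.Iio (0:ℝ), ∀ x, c₁ * ((0:ℝ) - t) ^ (-(3:ℝ) / 2) * Real.exp (-(‖x - (0 : EuclideanSpace ℝ (Fin 3))‖ ^ 2) / (c₂ * ((0:ℝ) - t))) ≤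 K t x ∧ K t x ≤ C₁ * ((0:ℝ) - t) ^ (-(3:ℝ) / 2) * Real.exp (-(‖x - (0 : EuclideanSpace ℝ (Fin 3))‖ ^ 2) / (C₂ * ((0:ℝ) - t)))) ∧ (∀ H Λ : ℝ → ℝ, H = (fun t => ∫ x, ‖Literature.Analysis.FluidPDE.curl (v t) x‖ ^ 2 * K t x) → Λ = (fun t => (0 - t) * deriv H t / H t) → (∀ t ∈ Set.Iio (0:ℝ), 0 < H t) ∧ (∀ t ∈ Set.Iio (0:ℝ), Λ t = Λ₀))) ∧ (∃ (ϖ : ℝ → EuclideanSpace ℝ (Fin 3) → ℝ) (G' : ℝ → EuclideanSpace ℝ (Fin 3) → EuclideanSpace ℝ (Fin 3) →L[ℝ] EuclideanSpace ℝ (Fin 3)), Literature.Analysis.FluidPDE.IsSuitableWeakSolutionOn (Literature.Analysis.FluidPDE.slab (EuclideanSpace ℝ (Fin 3)) (Set.Iio 0) isOpen_Iio) ν 0 v ϖ ∧ Literature.Analysis.FluidPDE.HasWeakSpatialGradientOn (Literature.Analysis.FluidPDE.slab (EuclideanSpace ℝ (Fin 3)) (Set.Iio 0) isOpen_Iio)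 v G' ∧ Literature.Analysis.FluidPDE.typeIBound (Set.Iio (0:ℝ) ×ˢ Set.univ) v ϖ G' < ⊤)) :=
  fun hL => finiteAB_stub2AB_of_recurrentLiouville hL recurrentReduction_proof

end Summit.NavierStokesRegularity.NavierStokesRegularity.Theorems

end
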